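import Mathlib.NumberTheory.SelbergSieve
import Mathlib.Data.Finset.NatDivisors
import Mathlib.Algebra.Order.Antidiag.Nat
import Literature.NumberTheory.Sieve.SieveFramework
import Literature.NumberTheory.LFunctions.MertensTail
import HarnessLib

/-!
# Selberg's `Λ²` upper-bound sieve: proof of the "Fundamental Theorem" (Heath-Brown §2, pp. 11–12); the shifted primes have sieve dimension `1`

Topic `Literature/NumberTheory/Sieve`, companion ("Proofs") file of `SieveFramework.lean`. It
DISCHARGES two named facts of `SieveFramework.lean`.

**Part 1.** `SelbergSieve.siftedSum_le_totalMass_div_selbergSum_add`: for every `S : SelbergSieve`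
of level `D`,

  `S(𝒜, P) ≤ X / G(√D) + ∑_{d ∣ P, d ≤ D} 3^{ω(d)} |R_d|`,  `G(√D) = ∑_{l ∣ P, l² ≤ D} g(l)`

(`SelbergSieve.siftedSum_le_totalMass_div_selbergSum_add_holds`), on top of Mathlib's
`Mathlib.NumberTheory.SelbergSieve` (which stops at the diagonalisation
`BoundingSieve.mainSum_lambdaSquared_eq_sum_mul_sum_sq` of the `Λ²` main term).

We follow Heath-Brown, *Lectures on sieves*, §2 "Selberg's sieve" (arXiv:math/0209360v1, pp. 6–12;
all page numbers below are those of the arXiv PDF, printed page = PDF page), which is Mathlib's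
reference, and equivalently Friedlander–Iwaniec, *Opera de Cribro*, §7.1, Thm 7.1;
Halberstam–Richert, *Sieve Methods*, Ch. 3, Thm 3.2:

* `SelbergSieve.optimalWeights`: the minimising weights (Heath-Brown §2, (2.3)–(2.4), p. 10)
  `λ_d = μ(d) ν(d)⁻¹ G⁻¹ ∑_{k ∣ P, d ∣ k, k² ≤ D} g(k)` for `d ∣ P` (and `0` otherwise), so that
  `λ_1 = 1` (`optimalWeights_one`) and `λ_d = 0` for `d² > D`;
* Heath-Brown Lemma 2.1, (2.2), p. 8 (Möbius inversion on the divisor lattice of `P`):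
  `∑_{d ∣ P, l ∣ d} ν(d) λ_d = [l² ≤ D] μ(l) g(l) / G` (`sum_ite_nu_mul_optimalWeights`), whence the
  main term `∑_{d ∣ P} Λ²(d) ν(d) = 1 / G` (`mainSum_lambdaSquared_optimalWeights`);
* Heath-Brown Lemma 2.2, (2.6), p. 11: `G ≥ (∑_{l ∣ d} g(l)) · ∑_{h ∣ P/d, (dh)² ≤ D} g(h)`, whence
  `|λ_d| ≤ 1` (p. 12)
  (`abs_optimalWeights_le_one`);
* `#{(d₁, d₂) : [d₁, d₂] = d} = 3^{ω(d)}` for squarefree `d` (Mathlib's `Nat.card_pair_lcm_eq`),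
  whence `|Λ²(d)| ≤ 3^{ω(d)}` (p. 12) and `Λ²(d) = 0` unless `d ≤ D` (p. 10)
  (`abs_lambdaSquared_optimalWeights_le`);
* assembly with Mathlib's `siftedSum_le_mainSum_errSum_of_upperMoebius` and
  `upperMoebius_lambdaSquared`.

**Part 2.** `Literature.NumberTheory.Sieve.hasSieveDimension_shiftedPrimes_one`
(`Literature.NumberTheory.Sieve.hasSieveDimension_shiftedPrimes_one_holds`, last section): for even `h` the density `g` of the
shifted primes `n ↦ Λ(n + h)` (`g(p) = 1/(p − 1)` for `p ∤ h`, `0` for `p ∣ h`) satisfies the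
dimension condition `Ω(1)`: `0 ≤ g(p) < 1` and `∏_{w ≤ p < z} (1 − g(p))⁻¹ ≤ K log z / log w` for
`2 ≤ w ≤ z`, with the explicit crude constant `K = exp(17/2 + 6/log 2)`. We follow Nathanson,
*Additive Number Theory*, §10.3 ("Prolegomena to sieving": the verification of the linear-sieve
hypotheses (9.33)–(9.34) for `g = 1/φ`, via `(1 − 1/(p−1))⁻¹ = (p−1)²/(p(p−2)) · (1 − 1/p)⁻¹` and
Mertens, Thm 6.9), in the additive form `(1 − g(p))⁻¹ ≤ exp(1/p + 4/(p(p−1)))`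
(`Literature.NumberTheory.Sieve.inv_one_sub_inv_sub_one_le_exp`) and
`∑_{w ≤ p < z} 1/p ≤ log log z − log log w + 9/2 + 6/log 2` (`Literature.NumberTheory.Sieve.sum_primesWindow_one_div_le`),
the latter from the tree's explicit Mertens bounds `MertensBound.sum_inv_prime_le`
(`∑_{p ≤ N} 1/p ≤ log log N + 4`) and `MertensBound.loglog_sub_loglog_le_sum_inv_prime`
(`∑_{P < p ≤ Q} 1/p ≥ log log Q − log log P − 6/log P`) of
`Literature/NumberTheory/LFunctions/MertensElementary.lean`, `MertensTail.lean`, together with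
`MertensBound.sum_inv_prime_mul_pred_le_one` (`∑_p 1/(p(p−1)) ≤ 1`).

## References

* D. R. Heath-Brown, *Lectures on sieves*, arXiv:math/0209360 (2002), §2 "Selberg's sieve"
  (pp. 6–12): Lemma 2.1 (p. 8), the minimising condition (2.3)–(2.4) and the bound (2.5) (p. 10),
  Lemma 2.2 (p. 11) and the "Fundamental Theorem for Selberg's sieve" (statement p. 11,
  proof p. 12).
* J. Friedlander, H. Iwaniec, *Opera de Cribro*, AMS Colloquium Publ. 57 (2010), Thm 7.1, §5.5.
* H. Halberstam, H.-E. Richert, *Sieve Methods* (1974), Thm 3.2; Ch. 1 Example 5 and Ch. 2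
  (condition `Ω₂(κ)`, Lemma 2.4).
* M. B. Nathanson, *Additive Number Theory: The Classical Bases*, GTM 164, Springer (1996):
  Thm 6.9 (Mertens, `∏_{u ≤ p < z} (1 − 1/p)⁻¹ < (1 + ε) log z / log u`; held copy PDF p. 105),
  the linear-sieve condition (9.29) (PDF p. 157), and §10.3 "Prolegomena to sieving"
  (PDF pp. 169–170: `g = 1/φ` satisfies (9.33)–(9.34)).
* G. H. Hardy, E. M. Wright, *An Introduction to the Theory of Numbers*, 6th ed. (2008), Thm 427
  (`∑_{p ≤ x} 1/p = log log x + B₁ + O(1/log x)`), Thm 429 (Mertens' product theorem).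
-/

open Finset
open scoped ArithmeticFunction.Moebius ArithmeticFunction.omega

noncomputable section

namespace Literature.NumberTheory.Sieve

/-- For coprime `m, n` the divisors of `m n` are the products `a b`, `a ∣ m`, `b ∣ n`, each exactly
once (`Nat.divisors_mul`, `Nat.Coprime.mul_injOn_divisors`). [folklore] -/
theorem sum_divisors_mul_of_coprime {m n : ℕ} (hmn : m.Coprime n) (f : ℕ → ℝ) :
    ∑ d ∈ (m * n).divisors, f d = ∑ a ∈ m.divisors, ∑ b ∈ n.divisors, f (a * b) := by
  rw [Nat.divisors_mul, ← Finset.image_mul_product, Finset.sum_image hmn.mul_injOn_divisors,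
    Finset.sum_product]

/-- `∑_{b ∣ m} μ(b) = [m = 1]` (in `ℝ`; Mathlib's `μ * ζ = 1`). [folklore] -/
theorem sum_divisors_moebius_real (m : ℕ) :
    ∑ b ∈ m.divisors, (μ b : ℝ) = if m = 1 then 1 else 0 := by
  have h := congrArg (fun f : ArithmeticFunction ℝ => f m)
    (ArithmeticFunction.coe_moebius_mul_coe_zeta (R := ℝ))
  simpa only [ArithmeticFunction.coe_mul_zeta_apply, ArithmeticFunction.intCoe_apply,
    ArithmeticFunction.one_apply] using h

/-- For squarefree `k`: `∑_{d ∣ k, l ∣ d} μ(d) = μ(l) [k = l]` (the Möbius sum over the interval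
`[l, k]` of the divisor lattice; Heath-Brown, proof of Lemma 2.1, p. 9). [folklore] -/
theorem sum_divisors_ite_dvd_moebius {k : ℕ} (hk : Squarefree k) (l : ℕ) :
    ∑ d ∈ k.divisors, (if l ∣ d then (μ d : ℝ) else 0) = if k = l then (μ k : ℝ) else 0 := by
  by_cases hl : l ∣ k
  · obtain ⟨m, rfl⟩ := hl
    have hlm : l.Coprime m := Nat.coprime_of_squarefree_mul hk
    have hl0 : l ≠ 0 := fun h => hk.ne_zero (by rw [h, zero_mul])
    have key : ∀ a ∈ l.divisors, ∀ b ∈ m.divisors, (l ∣ a * b ↔ a = l) := by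
      intro a ha b hb
      refine ⟨fun h => Nat.dvd_antisymm (Nat.dvd_of_mem_divisors ha) ?_,
        fun h => h ▸ dvd_mul_right _ _⟩
      exact (hlm.coprime_dvd_right (Nat.dvd_of_mem_divisors hb)).dvd_of_dvd_mul_right h
    rw [sum_divisors_mul_of_coprime hlm]
    calc ∑ a ∈ l.divisors, ∑ b ∈ m.divisors, (if l ∣ a * b then (μ (a * b) : ℝ) else 0)
        = ∑ a ∈ l.divisors, if a = l then ∑ b ∈ m.divisors, (μ (l * b) : ℝ) else 0 := by
          refine Finset.sum_congr rfl fun a ha => ?_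
          split_ifs with hal
          · subst hal
            exact Finset.sum_congr rfl fun b hb => if_pos (dvd_mul_right _ _)
          · exact Finset.sum_eq_zero fun b hb => if_neg fun h => hal ((key a ha b hb).mp h)
      _ = ∑ b ∈ m.divisors, (μ (l * b) : ℝ) := by
          rw [Finset.sum_ite_eq', if_pos (Nat.mem_divisors_self l hl0)]
      _ = (μ l : ℝ) * ∑ b ∈ m.divisors, (μ b : ℝ) := by
          rw [Finset.mul_sum]
          refine Finset.sum_congr rfl fun b hb => ?_
          rw [ArithmeticFunction.isMultiplicative_moebius.map_mul_of_coprime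
            (hlm.coprime_dvd_right (Nat.dvd_of_mem_divisors hb)), Int.cast_mul]
      _ = if l * m = l then (μ (l * m) : ℝ) else 0 := by
          rw [sum_divisors_moebius_real]
          by_cases hm : m = 1
          · subst hm
            simp
          · rw [if_neg hm, mul_zero, if_neg]
            exact fun h => hm ((mul_eq_left₀ hl0).mp h)
  · rw [if_neg fun h : k = l => hl (h ▸ dvd_rfl)]
    exact Finset.sum_eq_zero fun d hd => if_neg fun h => hl (h.trans (Nat.dvd_of_mem_divisors hd))

end Literature.NumberTheory.Sieve

/-! ### The optimal `Λ²` weights and the proof of the upper bound -/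

namespace SelbergSieve

open BoundingSieve Literature.NumberTheory.Sieve Literature.NumberTheory.LFunctions

variable (s : SelbergSieve)

/-- `s.upperSum d = ∑_{k ∣ P, d ∣ k, k² ≤ D} g(k)` (`= g(d) G_d(√D/d, z)` in Heath-Brown's notation,
§2, p. 10); `s.upperSum 1 = G(√D) = s.selbergSum`. [folklore] -/
def upperSum (d : ℕ) : ℝ :=
  ∑ k ∈ s.prodPrimes.divisors, if d ∣ k ∧ (k : ℝ) ^ 2 ≤ s.level then s.selbergTerms k else 0

/-- Selberg's optimal `Λ²` weights (Heath-Brown §2, p. 10, "the minimising condition" (2.3)–(2.4);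
Friedlander–Iwaniec §7.1): `λ_d = μ(d) ν(d)⁻¹ G⁻¹ ∑_{k ∣ P, d ∣ k, k² ≤ D} g(k)` for `d ∣ P`, and
`λ_d = 0` otherwise. [folklore] -/
def optimalWeights (d : ℕ) : ℝ :=
  if d ∣ s.prodPrimes then (μ d : ℝ) * (s.nu d)⁻¹ * s.selbergSum⁻¹ * s.upperSum d else 0

/-- `∑_{k ∣ P, k² ≤ D} g(k) = G(√D)`. [folklore] -/
theorem upperSum_one : s.upperSum 1 = s.selbergSum := by
  simp only [upperSum, one_dvd, true_and, selbergSum, Finset.sum_filter]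

/-- `upperSum d ≥ 0` (all `g(k) > 0`). [folklore] -/
theorem upperSum_nonneg (d : ℕ) : 0 ≤ s.upperSum d := by
  refine Finset.sum_nonneg fun k hk => ?_
  split_ifs
  · exact (selbergTerms_pos (Nat.dvd_of_mem_divisors hk)).le
  · exact le_rfl

/-- `upperSum d = 0` when `d² > D` (every multiple `k` of `d` has `k² ≥ d² > D`). [folklore] -/
theorem upperSum_eq_zero_of_lt {d : ℕ} (h : s.level < (d : ℝ) ^ 2) : s.upperSum d = 0 := by
  refine Finset.sum_eq_zero fun k hk => if_neg ?_
  rintro ⟨hdk, hk2⟩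
  have hle : (d : ℝ) ≤ k := by exact_mod_cast Nat.le_of_dvd (Nat.pos_of_mem_divisors hk) hdk
  exact (h.trans_le ((pow_le_pow_left₀ (Nat.cast_nonneg _) hle 2).trans hk2)).false

/-- `λ_1 = 1` (Heath-Brown, pp. 9–10: the normalisation forced by `y_l = μ(l) g(l) / G`).
[folklore] -/
theorem optimalWeights_one : s.optimalWeights 1 = 1 := by
  rw [optimalWeights, if_pos (one_dvd _), upperSum_one, ArithmeticFunction.moebius_apply_one,
    Int.cast_one, one_mul, s.nu_mult.map_one, inv_one, one_mul,
    inv_mul_cancel₀ (selbergSum_pos s).ne']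

/-- `λ_d = 0` when `d² > D` (the weights are supported on `d ≤ √D`). [folklore] -/
theorem optimalWeights_eq_zero_of_lt {d : ℕ} (h : s.level < (d : ℝ) ^ 2) :
    s.optimalWeights d = 0 := by
  rw [optimalWeights, upperSum_eq_zero_of_lt s h, mul_zero, ite_self]

/-- **Heath-Brown Lemma 2.2** ((2.6), p. 11) in the form
`∑_{k ∣ P, d ∣ k, k² ≤ D} g(k) ≤ ν(d) G(√D)` for `d ∣ P`:
writing `P = d e`, the left side is `g(d) ∑_{b ∣ e, (db)² ≤ D} g(b)`, while
`G ≥ ∑_{a ∣ d} ∑_{b ∣ e, (db)² ≤ D} g(a) g(b) = (g(d)/ν(d)) ∑_b g(b)` since `(ab)² ≤ (db)²` and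
`∑_{a ∣ d} g(a) = g(d)/ν(d)` (Mathlib's
`sum_divisors_selbergTerms_eq_selbergTerms_mul_nu_inv`). [folklore] -/
theorem upperSum_le_nu_mul_selbergSum {d : ℕ} (hd : d ∣ s.prodPrimes) :
    s.upperSum d ≤ s.nu d * s.selbergSum := by
  obtain ⟨e, he⟩ := id hd
  have hde : d.Coprime e := Nat.coprime_of_squarefree_mul (he ▸ s.prodPrimes_squarefree)
  have hd0 : d ≠ 0 := ne_zero_of_dvd_ne_zero prodPrimes_ne_zero hd
  have hν : 0 < s.nu d := nu_pos_of_dvd_prodPrimes hd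
  have hmult := (selbergTerms_isMultiplicative (s := s.toBoundingSieve))
  set B : ℝ := ∑ b ∈ e.divisors,
    if ((d * b : ℕ) : ℝ) ^ 2 ≤ s.level then s.selbergTerms b else 0 with hB
  have key : ∀ a ∈ d.divisors, ∀ b ∈ e.divisors, (d ∣ a * b ↔ a = d) := by
    intro a ha b hb
    refine ⟨fun h => Nat.dvd_antisymm (Nat.dvd_of_mem_divisors ha) ?_,
      fun h => h ▸ dvd_mul_right _ _⟩
    exact (hde.coprime_dvd_right (Nat.dvd_of_mem_divisors hb)).dvd_of_dvd_mul_right h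
  -- the left side is `g(d) B`
  have hT : s.upperSum d = s.selbergTerms d * B := by
    rw [upperSum, he, sum_divisors_mul_of_coprime hde]
    calc ∑ a ∈ d.divisors, ∑ b ∈ e.divisors,
          (if d ∣ a * b ∧ ((a * b : ℕ) : ℝ) ^ 2 ≤ s.level then s.selbergTerms (a * b) else 0)
        = ∑ a ∈ d.divisors, if a = d then ∑ b ∈ e.divisors,
            (if ((d * b : ℕ) : ℝ) ^ 2 ≤ s.level then s.selbergTerms (d * b) else 0) else 0 := by
          refine Finset.sum_congr rfl fun a ha => ?_
          split_ifs with had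
          · subst had
            refine Finset.sum_congr rfl fun b hb => ?_
            simp only [dvd_mul_right, true_and]
          · exact Finset.sum_eq_zero fun b hb => if_neg fun h => had ((key a ha b hb).mp h.1)
      _ = ∑ b ∈ e.divisors,
            (if ((d * b : ℕ) : ℝ) ^ 2 ≤ s.level then s.selbergTerms (d * b) else 0) := by
          rw [Finset.sum_ite_eq', if_pos (Nat.mem_divisors_self d hd0)]
      _ = s.selbergTerms d * B := by
          rw [hB, Finset.mul_sum]
          refine Finset.sum_congr rfl fun b hb => ?_
          rw [hmult.map_mul_of_coprime (hde.coprime_dvd_right (Nat.dvd_of_mem_divisors hb))]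
          split_ifs
          · rfl
          · exact (mul_zero _).symm
  -- Heath-Brown Lemma 2.2: `G ≥ (∑_{a ∣ d} g a) B = g(d) ν(d)⁻¹ B`
  have hG : s.selbergTerms d * (s.nu d)⁻¹ * B ≤ s.selbergSum := by
    have hsum : ∑ a ∈ d.divisors, s.selbergTerms a = s.selbergTerms d * (s.nu d)⁻¹ := by
      rw [← sum_divisors_selbergTerms_eq_selbergTerms_mul_nu_inv hd, ← Finset.sum_filter,
        Nat.divisors_filter_dvd_of_dvd prodPrimes_ne_zero hd]
    rw [← hsum, Finset.sum_mul]
    calc ∑ a ∈ d.divisors, s.selbergTerms a * B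
        = ∑ a ∈ d.divisors, ∑ b ∈ e.divisors, (if ((d * b : ℕ) : ℝ) ^ 2 ≤ s.level then
            s.selbergTerms a * s.selbergTerms b else 0) := by
          refine Finset.sum_congr rfl fun a ha => ?_
          rw [hB, Finset.mul_sum]
          refine Finset.sum_congr rfl fun b hb => ?_
          split_ifs
          · rfl
          · exact mul_zero _
      _ ≤ ∑ a ∈ d.divisors, ∑ b ∈ e.divisors,
            (if ((a * b : ℕ) : ℝ) ^ 2 ≤ s.level then s.selbergTerms (a * b) else 0) := by
          refine Finset.sum_le_sum fun a ha => Finset.sum_le_sum fun b hb => ?_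
          have hab : a.Coprime b :=
            (hde.coprime_dvd_left (Nat.dvd_of_mem_divisors ha)).coprime_dvd_right
              (Nat.dvd_of_mem_divisors hb)
          have habP : a * b ∣ s.prodPrimes :=
            he ▸ mul_dvd_mul (Nat.dvd_of_mem_divisors ha) (Nat.dvd_of_mem_divisors hb)
          rw [← hmult.map_mul_of_coprime hab]
          split_ifs with h1 h2
          · exact le_rfl
          · exfalso
            refine h2 (le_trans ?_ h1)
            have hle : ((a * b : ℕ) : ℝ) ≤ ((d * b : ℕ) : ℝ) := by
              exact_mod_cast Nat.mul_le_mul_right b (Nat.divisor_le ha)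
            exact pow_le_pow_left₀ (Nat.cast_nonneg _) hle 2
          · exact (selbergTerms_pos habP).le
          · exact le_rfl
      _ = s.selbergSum := by
          rw [selbergSum, Finset.sum_filter, he, sum_divisors_mul_of_coprime hde]
  rw [hT]
  calc s.selbergTerms d * B = s.nu d * (s.selbergTerms d * (s.nu d)⁻¹ * B) := by
        field_simp
    _ ≤ s.nu d * s.selbergSum := mul_le_mul_of_nonneg_left hG hν.le

/-- `|λ_d| ≤ 1` (Heath-Brown, p. 12, first line of the proof of the "Fundamental Theorem for
Selberg's sieve": "It follows from the relations (2.3) and (2.6) that `|λ_d| ≤ 1`", i.e. from the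
minimising condition and Lemma 2.2). [folklore] -/
theorem abs_optimalWeights_le_one (d : ℕ) : |s.optimalWeights d| ≤ 1 := by
  rw [optimalWeights]
  split_ifs with hd
  · have hν : 0 < s.nu d := nu_pos_of_dvd_prodPrimes hd
    have hG : 0 < s.selbergSum := selbergSum_pos s
    have hμ : |(μ d : ℝ)| ≤ 1 := by
      rw [← Int.cast_abs, ← Int.cast_one, Int.cast_le]
      exact ArithmeticFunction.abs_moebius_le_one
    rw [abs_mul, abs_mul, abs_mul, abs_of_pos (inv_pos.mpr hν), abs_of_pos (inv_pos.mpr hG),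
      abs_of_nonneg (upperSum_nonneg s d)]
    calc |(μ d : ℝ)| * (s.nu d)⁻¹ * s.selbergSum⁻¹ * s.upperSum d
        ≤ 1 * (s.nu d)⁻¹ * s.selbergSum⁻¹ * (s.nu d * s.selbergSum) := by
          gcongr <;> first
            | exact upperSum_nonneg s d
            | exact upperSum_le_nu_mul_selbergSum s hd
      _ = 1 := by field_simp
  · simp

/-- **Heath-Brown Lemma 2.1** ((2.2), p. 8) for the optimal weights (pp. 9–10): for `l ∣ P`,
`y_l = ∑_{d ∣ P, l ∣ d} ν(d) λ_d = [l² ≤ D] μ(l) g(l) / G(√D)` (swap the sums and use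
`∑_{l ∣ d ∣ k} μ(d) = μ(l) [k = l]`). [folklore] -/
theorem sum_ite_nu_mul_optimalWeights {l : ℕ} (hl : l ∣ s.prodPrimes) :
    ∑ d ∈ s.prodPrimes.divisors, (if l ∣ d then s.nu d * s.optimalWeights d else 0) =
      if (l : ℝ) ^ 2 ≤ s.level then (μ l : ℝ) * s.selbergTerms l * s.selbergSum⁻¹ else 0 := by
  have h1 : ∀ d ∈ s.prodPrimes.divisors,
      s.nu d * s.optimalWeights d = s.selbergSum⁻¹ * ((μ d : ℝ) * s.upperSum d) := by
    intro d hd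
    have hdP := Nat.dvd_of_mem_divisors hd
    rw [optimalWeights, if_pos hdP]
    calc s.nu d * ((μ d : ℝ) * (s.nu d)⁻¹ * s.selbergSum⁻¹ * s.upperSum d)
        = (s.nu d * (s.nu d)⁻¹) * (s.selbergSum⁻¹ * ((μ d : ℝ) * s.upperSum d)) := by ring
      _ = _ := by rw [mul_inv_cancel₀ (nu_ne_zero hdP), one_mul]
  calc ∑ d ∈ s.prodPrimes.divisors, (if l ∣ d then s.nu d * s.optimalWeights d else 0)
      = ∑ d ∈ s.prodPrimes.divisors,
          (if l ∣ d then s.selbergSum⁻¹ * ((μ d : ℝ) * s.upperSum d) else 0) :=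
        Finset.sum_congr rfl fun d hd => by rw [h1 d hd]
    _ = s.selbergSum⁻¹ * ∑ d ∈ s.prodPrimes.divisors,
          (if l ∣ d then (μ d : ℝ) * s.upperSum d else 0) := by
        rw [Finset.mul_sum]
        refine Finset.sum_congr rfl fun d hd => ?_
        split_ifs
        · rfl
        · exact (mul_zero _).symm
    _ = s.selbergSum⁻¹ * ∑ d ∈ s.prodPrimes.divisors, ∑ k ∈ s.prodPrimes.divisors,
          (if l ∣ d ∧ d ∣ k ∧ (k : ℝ) ^ 2 ≤ s.level then (μ d : ℝ) * s.selbergTerms k else 0) := by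
        congr 1
        refine Finset.sum_congr rfl fun d hd => ?_
        rw [upperSum, Finset.mul_sum]
        split_ifs with hld
        · refine Finset.sum_congr rfl fun k hk => ?_
          simp only [hld, true_and, mul_ite, mul_zero]
        · exact (Finset.sum_eq_zero fun k hk => if_neg fun h => hld h.1).symm
    _ = s.selbergSum⁻¹ * ∑ k ∈ s.prodPrimes.divisors, (if (k : ℝ) ^ 2 ≤ s.level
          then s.selbergTerms k else 0) * ∑ d ∈ k.divisors, (if l ∣ d then (μ d : ℝ) else 0) := by
        congr 1
        rw [Finset.sum_comm]
        refine Finset.sum_congr rfl fun k hk => ?_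
        rw [← Nat.divisors_filter_dvd_of_dvd prodPrimes_ne_zero (Nat.dvd_of_mem_divisors hk),
          Finset.sum_filter, Finset.mul_sum]
        refine Finset.sum_congr rfl fun d hd => ?_
        by_cases hA : l ∣ d <;> by_cases hB : d ∣ k <;> by_cases hC : (k : ℝ) ^ 2 ≤ s.level <;>
          simp [hA, hB, hC, mul_comm]
    _ = s.selbergSum⁻¹ * ∑ k ∈ s.prodPrimes.divisors, (if (k : ℝ) ^ 2 ≤ s.level
          then s.selbergTerms k else 0) * (if k = l then (μ k : ℝ) else 0) := by
        congr 1
        refine Finset.sum_congr rfl fun k hk => ?_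
        rw [sum_divisors_ite_dvd_moebius (squarefree_of_mem_divisors_prodPrimes hk)]
    _ = s.selbergSum⁻¹ * ((if (l : ℝ) ^ 2 ≤ s.level then s.selbergTerms l else 0) * (μ l : ℝ)) := by
        congr 1
        simp_rw [mul_ite, mul_zero]
        rw [Finset.sum_ite_eq', if_pos (Nat.mem_divisors.mpr ⟨hl, prodPrimes_ne_zero⟩)]
    _ = _ := by
        split_ifs <;> ring

/-- The main term for the optimal weights: `∑_{d ∣ P} Λ²(d) ν(d) = 1 / G(√D)` (Heath-Brown §2,
p. 10: `S₀ = ∑_l g(l)⁻¹ y_l² = G⁻¹` for `y_l = μ(l) g(l) / G`). [folklore] -/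
theorem mainSum_lambdaSquared_optimalWeights :
    s.mainSum (lambdaSquared s.optimalWeights) = s.selbergSum⁻¹ := by
  have hG : 0 < s.selbergSum := selbergSum_pos s
  rw [mainSum_lambdaSquared_eq_sum_mul_sum_sq]
  calc ∑ l ∈ s.prodPrimes.divisors, (s.selbergTerms l)⁻¹ *
        (∑ d ∈ s.prodPrimes.divisors, if l ∣ d then s.nu d * s.optimalWeights d else 0) ^ 2
      = ∑ l ∈ s.prodPrimes.divisors, (s.selbergTerms l)⁻¹ * (if (l : ℝ) ^ 2 ≤ s.level then
          (μ l : ℝ) * s.selbergTerms l * s.selbergSum⁻¹ else 0) ^ 2 := by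
        refine Finset.sum_congr rfl fun l hl => ?_
        rw [sum_ite_nu_mul_optimalWeights s (Nat.dvd_of_mem_divisors hl)]
    _ = ∑ l ∈ s.prodPrimes.divisors,
          (if (l : ℝ) ^ 2 ≤ s.level then s.selbergTerms l else 0) * (s.selbergSum⁻¹) ^ 2 := by
        refine Finset.sum_congr rfl fun l hl => ?_
        have hsq := squarefree_of_mem_divisors_prodPrimes hl
        have hg := (selbergTerms_pos (Nat.dvd_of_mem_divisors hl)).ne'
        have hμ : ((μ l : ℝ)) ^ 2 = 1 := by
          rw [← Int.cast_pow, ArithmeticFunction.moebius_sq_eq_one_of_squarefree hsq, Int.cast_one]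
        split_ifs
        · rw [mul_pow, mul_pow, hμ, one_mul]
          field_simp
        · simp
    _ = s.selbergSum * (s.selbergSum⁻¹) ^ 2 := by
        rw [← Finset.sum_mul, ← Finset.sum_filter]
        rfl
    _ = s.selbergSum⁻¹ := by
        field_simp

/-- `|Λ²(d)| ≤ 3^{ω(d)}` for `d ∣ P`, and `Λ²(d) = 0` unless `d ≤ D` (Heath-Brown p. 10,
(2.4)–(2.5): "`μ⁺(d) = 0` for `d ≥ y`, in view of (2.4)" [`λ_d = 0` for `d ≥ ξ`], and p. 12:
`|μ⁺(d)| ≤ ∑_{[d₁,d₂]=d} 1 = 3^{ν(d)}`, using `|λ_d| ≤ 1`). [folklore] -/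
theorem abs_lambdaSquared_optimalWeights_le {d : ℕ} (hd : d ∣ s.prodPrimes) :
    |lambdaSquared s.optimalWeights d| ≤ if (d : ℝ) ≤ s.level then (3 : ℝ) ^ ω d else 0 := by
  have hsq : Squarefree d := squarefree_of_dvd_prodPrimes hd
  have hy : 0 ≤ s.level := zero_le_one.trans s.one_le_level
  rw [lambdaSquared]
  split_ifs with hdy
  · calc |∑ d1 ∈ d.divisors, ∑ d2 ∈ d.divisors,
            (if d = d1.lcm d2 then s.optimalWeights d1 * s.optimalWeights d2 else 0)|
        ≤ ∑ d1 ∈ d.divisors, |∑ d2 ∈ d.divisors,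
            (if d = d1.lcm d2 then s.optimalWeights d1 * s.optimalWeights d2 else 0)| :=
          Finset.abs_sum_le_sum_abs _ _
      _ ≤ ∑ d1 ∈ d.divisors, ∑ d2 ∈ d.divisors,
            |(if d = d1.lcm d2 then s.optimalWeights d1 * s.optimalWeights d2 else 0)| :=
          Finset.sum_le_sum fun _ _ => Finset.abs_sum_le_sum_abs _ _
      _ ≤ ∑ d1 ∈ d.divisors, ∑ d2 ∈ d.divisors, (if d = d1.lcm d2 then (1 : ℝ) else 0) := by
          refine Finset.sum_le_sum fun d1 _ => Finset.sum_le_sum fun d2 _ => ?_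
          split_ifs
          · rw [abs_mul]
            exact mul_le_one₀ (abs_optimalWeights_le_one s d1) (abs_nonneg _)
              (abs_optimalWeights_le_one s d2)
          · rw [abs_zero]
      _ = #{p ∈ d.divisors ×ˢ d.divisors | d = p.1.lcm p.2} := by
          rw [← Finset.sum_product', Finset.sum_boole]
      _ = (3 : ℝ) ^ ω d := by
          simp_rw [eq_comm (a := d)]
          exact_mod_cast Nat.card_pair_lcm_eq hsq
  · rw [abs_nonpos_iff]
    refine Finset.sum_eq_zero fun d1 hd1 => Finset.sum_eq_zero fun d2 hd2 => ?_
    split_ifs with h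
    · by_contra hne
      obtain ⟨h1, h2⟩ := mul_ne_zero_iff.mp hne
      have h1' : (d1 : ℝ) ^ 2 ≤ s.level :=
        not_lt.mp fun hlt => h1 (optimalWeights_eq_zero_of_lt s hlt)
      have h2' : (d2 : ℝ) ^ 2 ≤ s.level :=
        not_lt.mp fun hlt => h2 (optimalWeights_eq_zero_of_lt s hlt)
      apply hdy
      have hd12 : d ≤ d1 * d2 := by
        rw [h]
        exact Nat.le_of_dvd (Nat.mul_pos (Nat.pos_of_mem_divisors hd1)
          (Nat.pos_of_mem_divisors hd2)) (Nat.lcm_dvd_mul d1 d2)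
      calc (d : ℝ) ≤ (d1 : ℝ) * d2 := by exact_mod_cast hd12
        _ ≤ s.level := by
          have hsq2 : ((d1 : ℝ) * d2) ^ 2 ≤ s.level ^ 2 := by
            rw [mul_pow, sq s.level]
            exact mul_le_mul h1' h2' (sq_nonneg _) hy
          exact (sq_le_sq₀ (by positivity) hy).mp hsq2
    · rfl

/-- **Selberg's `Λ²` upper-bound sieve** — DISCHARGE of the named fact
`SelbergSieve.siftedSum_le_totalMass_div_selbergSum_add` (`SieveFramework.lean`):
`S(𝒜, P) ≤ X / G(√D) + ∑_{d ∣ P, d ≤ D} 3^{ω(d)} |R_d|` (Heath-Brown, *Lectures on sieves*, §2,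
"Fundamental Theorem for Selberg's sieve", pp. 11–12; Friedlander–Iwaniec, *Opera de Cribro*,
Thm 7.1; Halberstam–Richert Thm 3.2). Proof: Mathlib's
`siftedSum_le_mainSum_errSum_of_upperMoebius` for the `Λ²` sieve with the optimal weights
`optimalWeights` (`upperMoebius_lambdaSquared`, `optimalWeights_one`), the main term
`mainSum_lambdaSquared_optimalWeights` and the error-term bound
`abs_lambdaSquared_optimalWeights_le`.
[cite: HeathBrownSieves2002, §2, Lemma 2.1, (2.3), Lemma 2.2 and the Fundamental Theorem, pp. 8–12]
[cite: FriedlanderIwaniecOpera2010, Thm. 7.1] -/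
theorem siftedSum_le_totalMass_div_selbergSum_add_holds :
    siftedSum_le_totalMass_div_selbergSum_add := by
  intro s
  have hmain := siftedSum_le_mainSum_errSum_of_upperMoebius (s := s.toBoundingSieve) _
    (upperMoebius_lambdaSquared s.optimalWeights (optimalWeights_one s))
  rw [mainSum_lambdaSquared_optimalWeights, ← div_eq_mul_inv] at hmain
  refine hmain.trans (add_le_add_right ?_ _)
  rw [errSum, Finset.sum_filter]
  refine Finset.sum_le_sum fun d hd => ?_
  have h := abs_lambdaSquared_optimalWeights_le s (Nat.dvd_of_mem_divisors hd)
  split_ifs at h ⊢ with hdy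
  · exact mul_le_mul_of_nonneg_right h (abs_nonneg _)
  · rw [le_antisymm h (abs_nonneg _), zero_mul]

end SelbergSieve

/-! ### The shifted primes have sieve dimension `1` (discharge of `Literature.NumberTheory.Sieve.hasSieveDimension_shiftedPrimes_one`) -/

namespace Literature.NumberTheory.Sieve

/-- The Euler factor of the shifted primes at a prime `p ≥ 3`: for real `p ≥ 3`,
`(1 − 1/(p−1))⁻¹ = 1 + 1/(p−2) ≤ exp(1/p + 4/(p(p−1)))`, from `1 + u ≤ eᵘ` and
`1/(p−2) ≤ 1/p + 4/(p(p−1))` (`⟺ p ≥ 3`) (Nathanson, *Additive Number Theory*, §10.3: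
`(1 − 1/(p−1))⁻¹ = (p−1)²/(p(p−2)) · (1 − 1/p)⁻¹`). [folklore] -/
theorem inv_one_sub_inv_sub_one_le_exp {p : ℝ} (hp : 3 ≤ p) :
    (1 - (p - 1)⁻¹)⁻¹ ≤ Real.exp (1 / p + 4 * (1 / (p * (p - 1)))) := by
  have hp0 : 0 < p := by linarith
  have hp1 : 0 < p - 1 := by linarith
  have hp2 : 0 < p - 2 := by linarith
  have hp1' : p - 1 ≠ 0 := hp1.ne'
  have hp2' : p - 2 ≠ 0 := hp2.ne'
  have e0 : 1 - (p - 1)⁻¹ = (p - 2) / (p - 1) := by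
    field_simp
    ring
  have e1 : (1 - (p - 1)⁻¹)⁻¹ = 1 / (p - 2) + 1 := by
    rw [e0, inv_div, div_add_one hp2', show (1 : ℝ) + (p - 2) = p - 1 by ring]
  have e2 : 1 / p + 4 * (1 / (p * (p - 1))) = (p + 3) / (p * (p - 1)) := by
    field_simp
    ring
  have key : 1 / (p - 2) ≤ (p + 3) / (p * (p - 1)) := by
    rw [div_le_div_iff₀ hp2 (mul_pos hp0 hp1)]
    nlinarith
  rw [e1, e2]
  linarith [key, Real.add_one_le_exp ((p + 3) / (p * (p - 1)))]

/-- The density of the shifted primes `n ↦ Λ(n + h)`, `h` even, at a prime `p`: either `g(p) = 0`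
(`p ∣ h`, in particular `p = 2`; or `h = 0`), or `p ≥ 3` and `g(p) = 1/φ(p) = 1/(p − 1)`
(Halberstam–Richert Ch. 1, Example 5; Nathanson §10.3: `0 < g(p) = 1/(p−1) < 1` for `p ∈ 𝒫`,
`2 ∉ 𝒫`). [folklore] -/
theorem shiftedPrimesDensity_prime_eq {h p : ℕ} (he : Even h) (hp : p.Prime) :
    shiftedPrimesDensity h p = 0 ∨ (3 ≤ p ∧ shiftedPrimesDensity h p = ((p : ℝ) - 1)⁻¹) := by
  rw [shiftedPrimesDensity_apply]
  by_cases hc : p.Coprime h ∧ p ≠ 0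
  · right
    have hp2 : p ≠ 2 := by
      rintro rfl
      have h1 : Nat.gcd 2 h = 1 := hc.1
      rw [Nat.gcd_eq_left (even_iff_two_dvd.mp he)] at h1
      exact absurd h1 (by decide)
    have hp3 : 3 ≤ p := by
      have := hp.two_le
      omega
    refine ⟨hp3, ?_⟩
    rw [if_pos hc, Nat.totient_prime hp, Nat.cast_pred hp.pos]
  · left
    rw [if_neg hc]

/-- **Mertens over a sieve window** (Hardy–Wright Thm 427; Nathanson Thm 6.9 is the sharp form
`∏_{u ≤ p < z} (1 − 1/p)⁻¹ < (1 + ε) log z / log u`): for real `2 ≤ w ≤ z`,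
`∑_{w ≤ p < z} 1/p ≤ log log z − log log w + 9/2 + 6/log 2`, from the tree's explicit bounds
`∑_{p ≤ N} 1/p ≤ log log N + 4` (`MertensBound.sum_inv_prime_le`) and
`∑_{2 < p ≤ w} 1/p ≥ log log w − log log 2 − 6/log 2` (`MertensBound.loglog_sub_loglog_le_sum_inv_prime`),
the window being contained in `{⌊w⌋} ∪ {p ≤ ⌊z⌋ : p > ⌊w⌋}`. [folklore] -/
theorem sum_primesWindow_one_div_le {w z : ℝ} (hw : 2 ≤ w) (hwz : w ≤ z) :
    ∑ p ∈ (Nat.primesBelow ⌈z⌉₊).filter (fun p : ℕ => w ≤ (p : ℝ)), (1 : ℝ) / p ≤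
      Real.log (Real.log z) - Real.log (Real.log w) + (9 / 2 + 6 / Real.log 2) := by
  set S := (Nat.primesBelow ⌈z⌉₊).filter (fun p : ℕ => w ≤ (p : ℝ)) with hS
  set T := Nat.primesLE ⌊z⌋₊ with hT
  have hz2 : (2 : ℝ) ≤ z := hw.trans hwz
  have hz0 : 0 < z := by linarith
  have hfz : 2 ≤ ⌊z⌋₊ := Nat.le_floor (by exact_mod_cast hz2)
  have hfw : 2 ≤ ⌊w⌋₊ := Nat.le_floor (by exact_mod_cast hw)
  -- the window inside `{⌊w⌋} ∪ {p ∈ T : p > ⌊w⌋}`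
  have hsub : S ⊆ insert ⌊w⌋₊ (T.filter fun p : ℕ => ¬ p ≤ ⌊w⌋₊) := by
    intro p hp
    rw [hS, Finset.mem_filter, Nat.mem_primesBelow] at hp
    obtain ⟨⟨hpz, hpp⟩, hwp⟩ := hp
    rw [Finset.mem_insert, Finset.mem_filter, hT, Nat.mem_primesLE]
    by_cases hpw : p = ⌊w⌋₊
    · exact Or.inl hpw
    · refine Or.inr ⟨⟨Nat.le_floor (Nat.lt_ceil.mp hpz).le, hpp⟩, fun hle => hpw ?_⟩
      have h1 : ⌊w⌋₊ ≤ p := by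
        have := Nat.floor_le_floor hwp
        rwa [Nat.floor_natCast] at this
      exact le_antisymm hle h1
  have hnotmem : ⌊w⌋₊ ∉ T.filter (fun p : ℕ => ¬ p ≤ ⌊w⌋₊) := by simp
  have h1 : ∑ p ∈ S, (1 : ℝ) / p ≤
      1 / (⌊w⌋₊ : ℝ) + ∑ p ∈ T.filter (fun p : ℕ => ¬ p ≤ ⌊w⌋₊), (1 : ℝ) / p := by
    have := Finset.sum_le_sum_of_subset_of_nonneg (f := fun p : ℕ => (1 : ℝ) / p) hsub
      (fun p _ _ => by positivity)
    rwa [Finset.sum_insert hnotmem] at this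
  -- split `T` at `⌊w⌋`
  have hsplit := Finset.sum_filter_add_sum_filter_not T (fun p : ℕ => p ≤ ⌊w⌋₊)
    (fun p : ℕ => (1 : ℝ) / p)
  -- Mertens II, upper half, up to `⌊z⌋`
  have hT4 : ∑ p ∈ T, (1 : ℝ) / p ≤ Real.log (Real.log z) + 4 := by
    refine (LFunctions.MertensBound.sum_inv_prime_le ⌊z⌋₊ hfz).trans ?_
    have h1' : (2 : ℝ) ≤ ⌊z⌋₊ := by exact_mod_cast hfz
    have h2' : (⌊z⌋₊ : ℝ) ≤ z := Nat.floor_le hz0.le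
    have h3' : 0 < Real.log ⌊z⌋₊ := Real.log_pos (by linarith)
    linarith [Real.log_le_log h3' (Real.log_le_log (by linarith) h2')]
  -- Mertens II, tail lower bound, for the primes of `(2, ⌊w⌋]`
  have hlow : Real.log (Real.log w) - Real.log (Real.log 2) - 6 / Real.log 2 ≤
      ∑ p ∈ T.filter (fun p : ℕ => p ≤ ⌊w⌋₊), (1 : ℝ) / p := by
    refine (LFunctions.MertensBound.loglog_sub_loglog_le_sum_inv_prime le_rfl hw).trans
      (Finset.sum_le_sum_of_subset_of_nonneg ?_ fun p _ _ => by positivity)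
    intro p hp
    simp only [Finset.mem_filter, Finset.mem_Ioc] at hp
    rw [Finset.mem_filter, hT, Nat.mem_primesLE]
    exact ⟨⟨hp.1.2.trans (Nat.floor_le_floor hwz), hp.2⟩, hp.1.2⟩
  have hhalf : 1 / (⌊w⌋₊ : ℝ) ≤ 1 / 2 := by
    have : (2 : ℝ) ≤ ⌊w⌋₊ := by exact_mod_cast hfw
    exact one_div_le_one_div_of_le two_pos this
  have hll2 : Real.log (Real.log 2) ≤ 0 := by
    refine Real.log_nonpos (Real.log_nonneg one_le_two) ?_
    have h2e : (2 : ℝ) ≤ Real.exp 1 := by linarith [Real.add_one_le_exp (1 : ℝ)]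
    calc Real.log 2 ≤ Real.log (Real.exp 1) := Real.log_le_log two_pos h2e
      _ = 1 := Real.log_exp 1
  linarith

/-- **The shifted primes have sieve dimension `1`** — DISCHARGE of the named fact
`hasSieveDimension_shiftedPrimes_one` (`SieveFramework.lean`). For even `h` the density of
`n ↦ Λ(n + h)` is `g(p) = 1/(p − 1)` for `p ∤ h` (so `p ≥ 3`) and `0` for `p ∣ h`; hence
`0 ≤ g(p) ≤ 1/2 < 1`, `(1 − g(p))⁻¹ ≤ exp(1/p + 4/(p(p−1)))`, and by Mertens
`∏_{w ≤ p < z} (1 − g(p))⁻¹ ≤ exp(∑_{w ≤ p < z} 1/p + 4 ∑_p 1/(p(p−1))) ≤ K log z / log w` with the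
explicit (crude) `K = exp(17/2 + 6/log 2)`; this is condition `Ω(1)` = Nathanson's linear-sieve
hypothesis (9.29) `∏_{u ≤ p < z} (1 − g(p))⁻¹ ≤ K log z / log u`, verified for `g = 1/φ` exactly as
in Nathanson §10.3 ("Prolegomena to sieving": `∏ (1 − 1/(p−1))⁻¹ = ∏ (p−1)²/(p(p−2)) · ∏ (1 − 1/p)⁻¹`
with Thm 6.9, Mertens); the named fact itself is cited from Halberstam–Richert (Ch. 2, condition
`Ω₂(κ)` with `κ = 1`; the shifted primes are Example 5 of Ch. 1) and Friedlander–Iwaniec §5.5.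
[cite: Nathanson1996, §10.3 (verification of (9.33)–(9.34) for g = 1/φ), Thm. 6.9 and (9.29)] -/
theorem hasSieveDimension_shiftedPrimes_one_holds : hasSieveDimension_shiftedPrimes_one := by
  intro h he
  -- `0 ≤ g(p) < 1` at every prime
  have hg : ∀ p : ℕ, p.Prime → 0 ≤ (SieveSequence.shiftedPrimes h).density p ∧
      (SieveSequence.shiftedPrimes h).density p < 1 := by
    intro p hp
    rw [SieveSequence.shiftedPrimes_density]
    rcases shiftedPrimesDensity_prime_eq he hp with h0 | ⟨hp3, h1⟩
    · rw [h0]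
      exact ⟨le_rfl, zero_lt_one⟩
    · rw [h1]
      have hp3' : (3 : ℝ) ≤ p := by exact_mod_cast hp3
      refine ⟨inv_nonneg.mpr (by linarith), ?_⟩
      calc ((p : ℝ) - 1)⁻¹ ≤ 2⁻¹ := inv_anti₀ two_pos (by linarith)
        _ < 1 := by norm_num
  refine ⟨Real.exp (17 / 2 + 6 / Real.log 2), hg, fun w z hw hwz => ?_⟩
  set S := (Nat.primesBelow ⌈z⌉₊).filter (fun p : ℕ => w ≤ (p : ℝ)) with hS
  have hlogw : 0 < Real.log w := Real.log_pos (by linarith)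
  have hlogz : 0 < Real.log z := Real.log_pos (by linarith)
  have hmemS : ∀ p ∈ S, p.Prime ∧ w ≤ (p : ℝ) ∧ p ≤ ⌊z⌋₊ := by
    intro p hp
    rw [hS, Finset.mem_filter, Nat.mem_primesBelow] at hp
    exact ⟨hp.1.2, hp.2, Nat.le_floor (Nat.lt_ceil.mp hp.1.1).le⟩
  have hSle : S ⊆ Nat.primesLE ⌊z⌋₊ := fun p hp =>
    Nat.mem_primesLE.mpr ⟨(hmemS p hp).2.2, (hmemS p hp).1⟩
  -- pointwise bound for the Euler factors
  have hpt : ∀ p ∈ S, (1 - (SieveSequence.shiftedPrimes h).density p)⁻¹ ≤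
      Real.exp (1 / (p : ℝ) + 4 * (1 / ((p : ℝ) * ((p : ℝ) - 1)))) := by
    intro p hp
    have hpp := (hmemS p hp).1
    have hp2 : (2 : ℝ) ≤ p := by exact_mod_cast hpp.two_le
    rw [SieveSequence.shiftedPrimes_density]
    rcases shiftedPrimesDensity_prime_eq he hpp with h0 | ⟨hp3, h1⟩
    · rw [h0, sub_zero, inv_one]
      have : (0 : ℝ) < (p : ℝ) * ((p : ℝ) - 1) := mul_pos (by linarith) (by linarith)
      exact Real.one_le_exp (by positivity)
    · rw [h1]
      exact inv_one_sub_inv_sub_one_le_exp (by exact_mod_cast hp3)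
  have hnonneg : ∀ p ∈ S, 0 ≤ (1 - (SieveSequence.shiftedPrimes h).density p)⁻¹ := fun p hp =>
    inv_nonneg.mpr (sub_nonneg.mpr (hg p (hmemS p hp).1).2.le)
  -- Mertens over the window, and the convergent correction
  have hsum1 : ∑ p ∈ S, (1 : ℝ) / p ≤
      Real.log (Real.log z) - Real.log (Real.log w) + (9 / 2 + 6 / Real.log 2) :=
    sum_primesWindow_one_div_le hw hwz
  have hsum2 : ∑ p ∈ S, (1 : ℝ) / (p * (p - 1)) ≤ 1 :=
    (Finset.sum_le_sum_of_subset_of_nonneg hSle fun p hp _ => by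
      have hp2 : (2 : ℝ) ≤ p := by exact_mod_cast (Nat.mem_primesLE.mp hp).2.two_le
      have : (0 : ℝ) < p * (p - 1) := mul_pos (by linarith) (by linarith)
      positivity).trans
      (LFunctions.MertensBound.sum_inv_prime_mul_pred_le_one ⌊z⌋₊)
  calc ∏ p ∈ S, (1 - (SieveSequence.shiftedPrimes h).density p)⁻¹
      ≤ ∏ p ∈ S, Real.exp (1 / (p : ℝ) + 4 * (1 / ((p : ℝ) * ((p : ℝ) - 1)))) :=
        Finset.prod_le_prod hnonneg hpt
    _ = Real.exp (∑ p ∈ S, (1 / (p : ℝ) + 4 * (1 / ((p : ℝ) * ((p : ℝ) - 1))))) := by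
        rw [Real.exp_sum]
    _ = Real.exp (∑ p ∈ S, 1 / (p : ℝ) + 4 * ∑ p ∈ S, 1 / ((p : ℝ) * ((p : ℝ) - 1))) := by
        rw [Finset.sum_add_distrib, Finset.mul_sum]
    _ ≤ Real.exp ((Real.log (Real.log z) - Real.log (Real.log w) + (9 / 2 + 6 / Real.log 2)) +
          4 * 1) := Real.exp_le_exp.mpr (by linarith)
    _ = Real.exp (17 / 2 + 6 / Real.log 2) * (Real.log z / Real.log w) ^ (1 : ℝ) := by
        rw [Real.rpow_one, show Real.log (Real.log z) - Real.log (Real.log w) +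
            (9 / 2 + 6 / Real.log 2) + 4 * 1 =
            (17 / 2 + 6 / Real.log 2) + (Real.log (Real.log z) - Real.log (Real.log w)) by ring,
          Real.exp_add, Real.exp_sub, Real.exp_log hlogz, Real.exp_log hlogw]

end Literature.NumberTheory.Sieve
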